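import Summits.BirchSwinnertonDyer.Rank1Residual.AdditivePotMult.ManinConstantDegree
import Summits.BirchSwinnertonDyer.Rank1Residual.AdditivePotMult.RankOneIndexValuation
import HarnessLib

/-!
# X3♯(M) / X4(M), rank one, per pair: the index BALANCE lever without the Manin constant
# (the datum `p ∤ c(D)` from `p ∤ deg(D)`, Česnavičius–Neururer–Saha 2024 Thm. 1.2 + tameness of (M))

HONEST FRAMING (cell `b2b-bsdres`, run/shared/lean/b2b/bsd-rank1-residual/, verbatim in every
file): the goal of the cell is to DELETE the COMBINATION-SHAPED residual classes of the
Birch–Swinnerton-Dyer formula for ALL analytic-rank `≤ 1` elliptic curves over `ℚ` — "full BSD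
formula for every rank `≤ 1` curve in class `C`" assembled STRICTLY from published theorems — so
that the rank-`≤ 1` remainder becomes exactly the CONSTRUCTION-SHAPED classes, which are TYPED
(missing-input `Prop`s), NOT attempted. This is not "finishing BSD". Sub-cell `additive-p1`
(CLASS-OWNERS row "X3/X4 additive — pot. multiplicative / X3♯(M)"), generation 14: research route;
no claim beyond the stated classes; theorems only, no definition, no new named fact (`hCNS` = A159
enters as a hypothesis); X3♯(M) and X4(M) stay CONSTRUCTION-SHAPED; no label moves; nothing booked.

WHAT THIS FILE DOES. Gen 10's per-pair BALANCE lever (`RankOneIndexValuation.lean`, p238988: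
`r_an(E) = 1`, ANY image, ANY Tamagawa numbers — the exact `ord_p #Ш(E)_an` from the Heegner-index
valuation at a field `K` with `d_K < −4`, the twist value `L(E^{d_K},1)/Ω`, `∏ c_ℓ(E)` and
`#E^{d_K}(ℚ)_tors`, by Gross–Zagier; then `BSD(E,p)` from the descent certificate `Ш(E)[p] = 0`)
carries the Manin datum `p ∤ c(Dt)` of the Gross–Zagier formula. On the (M) cells at every odd `p`
that datum follows from `p ∤ deg(Dt)` (`ManinConstantDegree.lean` §2:
`PotMult.not_dvd_maninConstant_of_not_dvd_modularDegree_of_odd`). Readings: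
`ClassX3M.bsdp_rankOne_of_indexBalance_of_noPTorsion_of_not_dvd_modularDegree` (the 4 383 + 221
reducible rank-one (M) classes at `3` of REPORT §17 list F / the window: certificate = balance row +
`3 ∤ deg φ` + the descent bit, with NO optimality / Manin-`1` entry) and the X4(M) twin.

References: [CesnaviciusNeururerSaha2023] Thm. 1.2; [JetchevSkinnerWan2017] §7.4.1;
[GrossZagier1986]; [Miller2011LMS] Def. 1.1.
-/

noncomputable section

open scoped Classical NumberField

open WeierstrassCurve NumberField Literature.NumberTheory.EllipticCurves
  Literature.NumberTheory.EllipticCurves.ModularForms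
  Literature.NumberTheory.EllipticCurves.Rank1Residual
  Literature.NumberTheory.EllipticCurves.Rank1Residual.Typed

namespace Summit.BirchSwinnertonDyer.Rank1Residual.AdditivePotMult

variable {W : WeierstrassCurve ℚ} [W.IsElliptic] [W.IsGloballyMinimal] {p : ℕ} [hp : Fact p.Prime]

/-- **X3♯(M) (reducible `E[p]`), rank one, ANY odd `p`, ANY Tamagawa numbers, NO Manin constant:
`BSD(E,p)` from the index balance and `Ш(E)[p] = 0`** — gen 10's
`ClassX3M.bsdp_rankOne_of_indexBalance_of_noPTorsion` with `p ∤ c(Dt)` replaced by `p ∤ deg(Dt)`.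
Named facts `hGZ` `hKo` `hGZK` `hmod` `hCNS`. [cite: CesnaviciusNeururerSaha2023, Thm. 1.2]
[cite: JetchevSkinnerWan2017, §7.4.1 (eq:gz for K′), p. 30] [cite: Miller2011LMS, §1 and Def. 1.1] -/
theorem ClassX3M.bsdp_rankOne_of_indexBalance_of_noPTorsion_of_not_dvd_modularDegree
    [NeZero (W.conductorNorm ℤ)]
    (hCNS : cesnaviciusNeururerSaha_padicVal_maninConstant_le_modularDegree)
    (hX : ClassX3M W p) (hr : W.analyticRank = 1)
    (K : Type) [Field K] [NumberField K]
    (Dt : ModularParametrizationData W (W.conductorNorm ℤ))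
    (H : HeegnerDatum (W.conductorNorm ℤ) (NumberField.discr K)) (ι : K →+* ℂ)
    (P : (W.baseChange K).toAffine.Point)
    (hGZ : gross_zagier (W.conductorNorm ℤ) W K) (hKo : kolyvagin (W.conductorNorm ℤ) W K)
    (hGZK : rank_eq_analyticRank_of_analyticRank_le_one) (hmod : hasEntireLFunction_rat)
    (hK : IsImaginaryQuadratic K) (hHN : SatisfiesHeegnerHypothesis (W.conductorNorm ℤ) K)
    (hdK : NumberField.discr K < -4)
    (hP : WeierstrassCurve.Affine.Point.map ι.toRatAlgHom P = heegnerPointComplex Dt H)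
    (hdeg : ¬ p ∣ Dt.modularDegree)
    (hLt : (W.quadraticTwist (NumberField.discr K : ℚ)).entireLFunction 1 ≠ 0)
    (Wd : WeierstrassCurve ℚ) [Wd.IsElliptic] [Wd.IsGloballyMinimal] (Cd : VariableChange ℚ)
    (hWd : Cd • W.quadraticTwist (NumberField.discr K : ℚ) = Wd)
    (qd : ℚ) (hqd : Wd.entireLFunction 1 / (Wd.realPeriodRat : ℂ) = (qd : ℂ))
    (hbal : 2 * (padicValNat p (AddSubgroup.zmultiples P).index : ℤ) =
      padicValRat p qd + padicValNat p W.tamagawaProduct + 2 * padicValNat p Wd.torsionOrder)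
    (hSha : ∀ x : W.sha, (p : ℤ) • x = 0 → x = 0) : BSDp W p :=
  hX.bsdp_rankOne_of_indexBalance_of_noPTorsion hr K Dt H ι P hGZ hKo hGZK hmod hK hHN hdK hP
    (hX.not_dvd_maninConstant_of_not_dvd_modularDegree hCNS Dt hdeg) hLt Wd Cd hWd qd hqd hbal hSha

/-- **X4(M), rank one, ANY odd `p`, ANY image, ANY Tamagawa numbers, NO Manin constant: `BSD(E,p)`
from the index balance and `Ш(E)[p] = 0`** — gen 10's `ClassX4M.bsdp_rankOne_of_indexBalance_of_noPTorsion`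
with `p ∤ c(Dt)` replaced by `p ∤ deg(Dt)` (the Tamagawa-obstructed rank-one (M) classes at `3`,
REPORT §17 lists C/E: balance row + `3 ∤ deg φ` + the `dim Sel₃ = 1` bit). Named facts `hGZ` `hKo`
`hGZK` `hmod` `hCNS`. [cite: CesnaviciusNeururerSaha2023, Thm. 1.2]
[cite: JetchevSkinnerWan2017, §7.4.1 (eq:gz for K′), p. 30] [cite: Miller2011LMS, §1 and Def. 1.1] -/
theorem ClassX4M.bsdp_rankOne_of_indexBalance_of_noPTorsion_of_not_dvd_modularDegree
    [NeZero (W.conductorNorm ℤ)]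
    (hCNS : cesnaviciusNeururerSaha_padicVal_maninConstant_le_modularDegree)
    (hX : ClassX4M W p) (hr : W.analyticRank = 1)
    (K : Type) [Field K] [NumberField K]
    (Dt : ModularParametrizationData W (W.conductorNorm ℤ))
    (H : HeegnerDatum (W.conductorNorm ℤ) (NumberField.discr K)) (ι : K →+* ℂ)
    (P : (W.baseChange K).toAffine.Point)
    (hGZ : gross_zagier (W.conductorNorm ℤ) W K) (hKo : kolyvagin (W.conductorNorm ℤ) W K)
    (hGZK : rank_eq_analyticRank_of_analyticRank_le_one) (hmod : hasEntireLFunction_rat)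
    (hK : IsImaginaryQuadratic K) (hHN : SatisfiesHeegnerHypothesis (W.conductorNorm ℤ) K)
    (hdK : NumberField.discr K < -4)
    (hP : WeierstrassCurve.Affine.Point.map ι.toRatAlgHom P = heegnerPointComplex Dt H)
    (hdeg : ¬ p ∣ Dt.modularDegree)
    (hLt : (W.quadraticTwist (NumberField.discr K : ℚ)).entireLFunction 1 ≠ 0)
    (Wd : WeierstrassCurve ℚ) [Wd.IsElliptic] [Wd.IsGloballyMinimal] (Cd : VariableChange ℚ)
    (hWd : Cd • W.quadraticTwist (NumberField.discr K : ℚ) = Wd)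
    (qd : ℚ) (hqd : Wd.entireLFunction 1 / (Wd.realPeriodRat : ℂ) = (qd : ℂ))
    (hbal : 2 * (padicValNat p (AddSubgroup.zmultiples P).index : ℤ) =
      padicValRat p qd + padicValNat p W.tamagawaProduct + 2 * padicValNat p Wd.torsionOrder)
    (hSha : ∀ x : W.sha, (p : ℤ) • x = 0 → x = 0) : BSDp W p :=
  hX.bsdp_rankOne_of_indexBalance_of_noPTorsion hr K Dt H ι P hGZ hKo hGZK hmod hK hHN hdK hP
    (hX.not_dvd_maninConstant_of_not_dvd_modularDegree hCNS Dt hdeg) hLt Wd Cd hWd qd hqd hbal hSha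

end Summit.BirchSwinnertonDyer.Rank1Residual.AdditivePotMult

end
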